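import Summits.QuantumFields.YangMills.Theorems.BrascampLiebVacuumSC.Negative.DmaxIntegrandMeasurable
import Literature.Probability.LatticeModels.TorusFourierProofs

/-!
# `ConvexGribovBody.BrascampLiebVacuumSC` — negative lane: Parseval lower bound on the covariance
# scale `Dmax` (refuter / standing disprover, crux stmt-QuantumFields-16404)

Companion of `Negative/DmaxFloor.lean` ("the crux FORCES `inf_{S ≥ S₁} Dmax(β, S) > 0`"). This
file identifies what such a floor amounts to for the minimal lattice Coulomb gauge ALONE:

* `cruxPhase_eq_prod_stdAddChar` — the crux's Fourier phase
  `exp(−2πi Σᵢ pᵢ.val yᵢ.val / L)` is the conjugate character `∏ᵢ e(−pᵢ yᵢ)` of `(ℤ/L)³`, so the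
  crux's momentum sums are the tree's `torusFourier` (Mathlib's `ZMod.dft` convention);
* `sum_norm_sq_sum_cruxPhase_mul`, `sum_fro_sum_cruxPhase_smul` — Parseval in that convention,
  scalar and Frobenius-matrix form: `Σ_p ‖Σ_y c(p,y) • M_y‖²_F = L³ Σ_y ‖M_y‖²_F`
  (tree `torusFourier_plancherel_holds`);
* `dmax_ge_parseval` — **`Dmax(β, S) ≥ L⁻³ · E[ sup_{h ∈ argmin coul(U,·)} Σ_{j,y} ‖A^h_j(y)‖²_F ]`**
  (`A^h_j(y) = ½(ρ(U^h_{y,j}) − ρ(U^h_{y,j})ᴴ)` the anti-Hermitian part of the gauge-fixed slice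
  link): sup over momenta ≥ average; average of per-momentum sups ≥ sup of the average
  (`le_ciSup` termwise); Parseval; `integral_finsetSum` / `integral_mono_of_nonneg` thanks to
  `integrable_dmaxIntegrand`.

Reading. `L⁻³ Σ_{j,y} = 3 · (mean over the 3L³ slice links)`, so a volume-uniform floor on
`Dmax` FOLLOWS from `E[sup_h mean_ℓ ‖A^h_ℓ‖²_F] ≥ a(β) > 0` — a statement about the minimal
Coulomb gauge with no test functions in it; conversely the disprover's degeneration lever
(`brascampLiebVacuumSC_false_of_dmaxDegenerate`) needs at least `E[sup_h mean_ℓ ‖A^h_ℓ‖²] → 0`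
along `S → ∞`, for which no mechanism is known (in any gauge the link deficits dominate the
plaquette deficits, which are extensive). Everything proved; nothing here asserts a Theses
statement.
-/

noncomputable section

open scoped BigOperators Topology Matrix ComplexConjugate
open Filter MeasureTheory Function Set Complex
open Literature.MathematicalPhysics.QuantumFieldTheory
open Literature.Probability.LatticeModels (torusFourier torusChar prod_stdAddChar_neg stdAddChar_mul_eq_exp
  torusFourier_plancherel_holds)
open Summit.QuantumFields.YangMills.Theorems.BrascampLiebVacuum.Negative

namespace Summit.QuantumFields.YangMills.Theorems.BrascampLiebVacuumSC.Negative

section Fourier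

/-- The crux's Fourier phase is the conjugate torus character:
`exp(−2πi Σᵢ pᵢ.val yᵢ.val / L) = ∏ᵢ e(−pᵢ yᵢ)`. [folklore] -/
theorem cruxPhase_eq_prod_stdAddChar (S : ℕ) (p y : Fin 3 → ZMod (2 * S + 1)) :
    Complex.exp (-(2 * Real.pi * Complex.I *
        (∑ i : Fin 3, ((p i).val : ℂ) * ((y i).val : ℂ)) / (2 * S + 1 : ℂ))) =
      ∏ i, (ZMod.stdAddChar (-(p i * y i)) : ℂ) := by
  rw [prod_stdAddChar_neg, torusChar]
  simp_rw [stdAddChar_mul_eq_exp]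
  rw [← Complex.exp_sum, ← Complex.exp_conj, map_sum]
  congr 1
  rw [Finset.mul_sum, Finset.sum_div, ← Finset.sum_neg_distrib]
  refine Finset.sum_congr rfl fun i _ => ?_
  have hL : ((2 * S + 1 : ℕ) : ℂ) = (2 * S + 1 : ℂ) := by push_cast; ring
  rw [← hL]
  simp only [map_div₀, map_mul, map_ofNat, Complex.conj_ofReal, Complex.conj_I, map_natCast]
  push_cast
  ring

/-- **Scalar Parseval in the crux's convention**: `Σ_p |Σ_y c(p,y) m_y|² = L³ Σ_y |m_y|²`. [folklore] -/
theorem sum_norm_sq_sum_cruxPhase_mul (S : ℕ) (m : (Fin 3 → ZMod (2 * S + 1)) → ℂ) :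
    ∑ p : Fin 3 → ZMod (2 * S + 1), ‖∑ y : Fin 3 → ZMod (2 * S + 1),
        Complex.exp (-(2 * Real.pi * Complex.I *
          (∑ i : Fin 3, ((p i).val : ℂ) * ((y i).val : ℂ)) / (2 * S + 1 : ℂ))) * m y‖ ^ 2 =
      (2 * S + 1 : ℝ) ^ 3 * ∑ y, ‖m y‖ ^ 2 := by
  have h : ∀ p : Fin 3 → ZMod (2 * S + 1), ∑ y : Fin 3 → ZMod (2 * S + 1),
      Complex.exp (-(2 * Real.pi * Complex.I *
        (∑ i : Fin 3, ((p i).val : ℂ) * ((y i).val : ℂ)) / (2 * S + 1 : ℂ))) * m y =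
      torusFourier m p := fun p => by
    rw [torusFourier]
    refine Finset.sum_congr rfl fun y _ => ?_
    rw [cruxPhase_eq_prod_stdAddChar, mul_comm]
  simp_rw [h]
  have hP := torusFourier_plancherel_holds (d := 3) (L := 2 * S + 1) m
  rw [hP]
  push_cast
  ring

/-- **Matrix Parseval in the crux's convention** (`fro` = squared Frobenius norm):
`Σ_p fro(Σ_y c(p,y) • M_y) = L³ Σ_y fro(M_y)`. [folklore] -/
theorem sum_fro_sum_cruxPhase_smul (S : ℕ) {N : ℕ}
    (M : (Fin 3 → ZMod (2 * S + 1)) → Matrix (Fin N) (Fin N) ℂ) :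
    ∑ p : Fin 3 → ZMod (2 * S + 1), ∑ a, ∑ b, ‖(∑ y : Fin 3 → ZMod (2 * S + 1),
        Complex.exp (-(2 * Real.pi * Complex.I *
          (∑ i : Fin 3, ((p i).val : ℂ) * ((y i).val : ℂ)) / (2 * S + 1 : ℂ))) • M y) a b‖ ^ 2 =
      (2 * S + 1 : ℝ) ^ 3 * ∑ y, ∑ a, ∑ b, ‖M y a b‖ ^ 2 := by
  have happ : ∀ (p : Fin 3 → ZMod (2 * S + 1)) (a b : Fin N),
      (∑ y : Fin 3 → ZMod (2 * S + 1),
        Complex.exp (-(2 * Real.pi * Complex.I *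
          (∑ i : Fin 3, ((p i).val : ℂ) * ((y i).val : ℂ)) / (2 * S + 1 : ℂ))) • M y) a b =
      ∑ y : Fin 3 → ZMod (2 * S + 1),
        Complex.exp (-(2 * Real.pi * Complex.I *
          (∑ i : Fin 3, ((p i).val : ℂ) * ((y i).val : ℂ)) / (2 * S + 1 : ℂ))) * M y a b := by
    intro p a b
    rw [Matrix.sum_apply]
    refine Finset.sum_congr rfl fun y _ => ?_
    rw [Matrix.smul_apply, smul_eq_mul]
  simp_rw [happ]
  rw [Finset.sum_comm]
  simp_rw [Finset.sum_comm (s := (Finset.univ : Finset (Fin 3 → ZMod (2 * S + 1))))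
    (t := (Finset.univ : Finset (Fin N)))]
  simp_rw [sum_norm_sq_sum_cruxPhase_mul, ← Finset.mul_sum]


end Fourier

section Dmax

variable {G : Type*} [Group G] [TopologicalSpace G] [IsTopologicalGroup G] [CompactSpace G]
  [MeasurableSpace G] [BorelSpace G]

/-- **Parseval lower bound on the covariance scale**: `Dmax ≥ L⁻³ · E[ sup_{h ∈ argmin} Σ_{j,y}
‖A^h_j(y)‖²_F ]` — the sup over momenta dominates the average, the average over momenta of the
per-momentum sups dominates the sup of the average, and the momentum average of `cov` is, by
Parseval, `L⁻³ Σ_{j,y} ‖A^h_j(y)‖²_F` (`A` = anti-Hermitian part of the gauge-fixed slice links).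
Uses `integrable_dmaxIntegrand` (`Negative/DmaxIntegrandMeasurable.lean`). [folklore] -/
theorem dmax_ge_parseval (r : LatticeRep G) (β : ℝ) (S : ℕ) :
    let fro : Matrix (Fin r.N) (Fin r.N) ℂ → ℝ := fun M => ∑ a, ∑ b, ‖M a b‖ ^ 2
    let Amass : GaugeConfig 4 (2 * S + 1) G → (Site 4 (2 * S + 1) → G) → ℝ := fun U h =>
      ∑ j : Fin 3, ∑ y : Fin 3 → ZMod (2 * S + 1),
        fro ((1 / 2 : ℂ) • (r.ρ (gaugeTransform h U (Fin.cons (0 : ZMod (2 * S + 1)) y, j.succ)) -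
          (r.ρ (gaugeTransform h U (Fin.cons (0 : ZMod (2 * S + 1)) y, j.succ)))ᴴ))
    let μ := wilsonMeasure (d := 4) (L := 2 * S + 1) r.ρ β
    let coul : GaugeConfig 4 (2 * S + 1) G → (Site 4 (2 * S + 1) → G) → ℝ := fun U h =>
      -∑ e : Edge 4 (2 * S + 1),
        (if e.1 0 = 0 ∧ e.2 ≠ 0 then (r.ρ (gaugeTransform h U e)).trace.re else 0)
    let cov : GaugeConfig 4 (2 * S + 1) G → (Site 4 (2 * S + 1) → G) →
        (Fin 3 → ZMod (2 * S + 1)) → ℝ := fun U h p =>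
      (∑ j : Fin 3, fro (∑ y : Fin 3 → ZMod (2 * S + 1),
        Complex.exp (-(2 * Real.pi * Complex.I *
          (∑ i : Fin 3, ((p i).val : ℂ) * ((y i).val : ℂ)) / (2 * S + 1 : ℂ))) •
        ((1 / 2 : ℂ) • (r.ρ (gaugeTransform h U (Fin.cons (0 : ZMod (2 * S + 1)) y, j.succ)) -
          (r.ρ (gaugeTransform h U (Fin.cons (0 : ZMod (2 * S + 1)) y, j.succ)))ᴴ)))) /
        ((2 * S + 1 : ℝ) ^ 3)
    let Dmax : ℝ := ⨆ p : Fin 3 → ZMod (2 * S + 1),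
      ∫ U, (⨆ h : {h : Site 4 (2 * S + 1) → G // ∀ h', coul U h ≤ coul U h'}, cov U h.1 p) ∂μ
    (1 / (2 * S + 1 : ℝ) ^ 3) *
      ∫ U, (⨆ h : {h : Site 4 (2 * S + 1) → G // ∀ h', coul U h ≤ coul U h'}, Amass U h.1) ∂μ ≤
      Dmax := by
  intro fro Amass μ coul cov Dmax
  have hint := fun p => integrable_dmaxIntegrand r β S p
  have hL : (0 : ℝ) < (2 * S + 1 : ℝ) ^ 3 := by positivity
  have hcard : (Fintype.card (Fin 3 → ZMod (2 * S + 1)) : ℝ) = (2 * S + 1 : ℝ) ^ 3 := by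
    rw [Fintype.card_fun, ZMod.card, Fintype.card_fin]; push_cast; ring
  -- pointwise bounds on `cov` (as in `dmax_le_volume`)
  have hsq : ((2 * S + 1 : ℝ) ^ 3 * Real.sqrt r.N) ^ 2 = (r.N : ℝ) * ((2 * S + 1 : ℝ) ^ 3) ^ 2 := by
    rw [mul_pow, Real.sq_sqrt (Nat.cast_nonneg _)]; ring
  have hcov : ∀ U h p, cov U h p ≤ 3 * (r.N : ℝ) * (2 * S + 1 : ℝ) ^ 3 := by
    intro U h p
    have hj : ∀ j : Fin 3, fro (∑ y : Fin 3 → ZMod (2 * S + 1),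
        Complex.exp (-(2 * Real.pi * Complex.I *
          (∑ i : Fin 3, ((p i).val : ℂ) * ((y i).val : ℂ)) / (2 * S + 1 : ℂ))) •
        ((1 / 2 : ℂ) • (r.ρ (gaugeTransform h U (Fin.cons (0 : ZMod (2 * S + 1)) y, j.succ)) -
          (r.ρ (gaugeTransform h U (Fin.cons (0 : ZMod (2 * S + 1)) y, j.succ)))ᴴ))) ≤
        (r.N : ℝ) * ((2 * S + 1 : ℝ) ^ 3) ^ 2 := fun j => by
      have h1 := sum_norm_sq_sum_smul_le (ι := Fin 3 → ZMod (2 * S + 1))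
        (fun y => Complex.exp (-(2 * Real.pi * Complex.I *
          (∑ i : Fin 3, ((p i).val : ℂ) * ((y i).val : ℂ)) / (2 * S + 1 : ℂ))))
        (fun y => (1 / 2 : ℂ) • (r.ρ (gaugeTransform h U (Fin.cons (0 : ZMod (2 * S + 1)) y, j.succ)) -
          (r.ρ (gaugeTransform h U (Fin.cons (0 : ZMod (2 * S + 1)) y, j.succ)))ᴴ))
        (fun y => norm_exp_phase S p y) (fun y => norm_antiHermitianPart_le r _)
      rw [hcard, hsq] at h1
      exact h1
    have hsum : (∑ j : Fin 3, fro (∑ y : Fin 3 → ZMod (2 * S + 1),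
        Complex.exp (-(2 * Real.pi * Complex.I *
          (∑ i : Fin 3, ((p i).val : ℂ) * ((y i).val : ℂ)) / (2 * S + 1 : ℂ))) •
        ((1 / 2 : ℂ) • (r.ρ (gaugeTransform h U (Fin.cons (0 : ZMod (2 * S + 1)) y, j.succ)) -
          (r.ρ (gaugeTransform h U (Fin.cons (0 : ZMod (2 * S + 1)) y, j.succ)))ᴴ)))) ≤
        3 * (r.N : ℝ) * (2 * S + 1 : ℝ) ^ 3 * (2 * S + 1 : ℝ) ^ 3 :=
      calc _ ≤ ∑ _j : Fin 3, (r.N : ℝ) * ((2 * S + 1 : ℝ) ^ 3) ^ 2 :=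
            Finset.sum_le_sum fun j _ => hj j
        _ = 3 * (r.N : ℝ) * (2 * S + 1 : ℝ) ^ 3 * (2 * S + 1 : ℝ) ^ 3 := by
            rw [Finset.sum_const, Finset.card_univ, Fintype.card_fin, nsmul_eq_mul]; push_cast; ring
    exact (div_le_iff₀ (by positivity)).2 hsum
  have hcov0 : ∀ U h p, 0 ≤ cov U h p := fun U h p => by
    refine div_nonneg (Finset.sum_nonneg fun j _ => ?_) (by positivity)
    exact Finset.sum_nonneg fun a _ => Finset.sum_nonneg fun b _ => by positivity
  have hbdd : ∀ U p, BddAbove (Set.range fun h : {h : Site 4 (2 * S + 1) → G //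
      ∀ h', coul U h ≤ coul U h'} => cov U h.1 p) := fun U p =>
    ⟨3 * (r.N : ℝ) * (2 * S + 1 : ℝ) ^ 3, by rintro _ ⟨h, rfl⟩; exact hcov U h.1 p⟩
  -- Parseval: `Σ_p cov U h p = Amass U h`
  have hpars : ∀ U h, ∑ p, cov U h p = Amass U h := by
    intro U h
    change ∑ p : Fin 3 → ZMod (2 * S + 1), (∑ j : Fin 3, fro (∑ y : Fin 3 → ZMod (2 * S + 1),
        Complex.exp (-(2 * Real.pi * Complex.I *
          (∑ i : Fin 3, ((p i).val : ℂ) * ((y i).val : ℂ)) / (2 * S + 1 : ℂ))) •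
        ((1 / 2 : ℂ) • (r.ρ (gaugeTransform h U (Fin.cons (0 : ZMod (2 * S + 1)) y, j.succ)) -
          (r.ρ (gaugeTransform h U (Fin.cons (0 : ZMod (2 * S + 1)) y, j.succ)))ᴴ)))) /
        ((2 * S + 1 : ℝ) ^ 3) = ∑ j : Fin 3, ∑ y : Fin 3 → ZMod (2 * S + 1),
        fro ((1 / 2 : ℂ) • (r.ρ (gaugeTransform h U (Fin.cons (0 : ZMod (2 * S + 1)) y, j.succ)) -
          (r.ρ (gaugeTransform h U (Fin.cons (0 : ZMod (2 * S + 1)) y, j.succ)))ᴴ))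
    rw [← Finset.sum_div, Finset.sum_comm]
    have hj : ∀ j : Fin 3, ∑ p : Fin 3 → ZMod (2 * S + 1), fro (∑ y : Fin 3 → ZMod (2 * S + 1),
        Complex.exp (-(2 * Real.pi * Complex.I *
          (∑ i : Fin 3, ((p i).val : ℂ) * ((y i).val : ℂ)) / (2 * S + 1 : ℂ))) •
        ((1 / 2 : ℂ) • (r.ρ (gaugeTransform h U (Fin.cons (0 : ZMod (2 * S + 1)) y, j.succ)) -
          (r.ρ (gaugeTransform h U (Fin.cons (0 : ZMod (2 * S + 1)) y, j.succ)))ᴴ))) =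
        (2 * S + 1 : ℝ) ^ 3 * ∑ y : Fin 3 → ZMod (2 * S + 1),
          fro ((1 / 2 : ℂ) • (r.ρ (gaugeTransform h U (Fin.cons (0 : ZMod (2 * S + 1)) y, j.succ)) -
            (r.ρ (gaugeTransform h U (Fin.cons (0 : ZMod (2 * S + 1)) y, j.succ)))ᴴ)) :=
      fun j => sum_fro_sum_cruxPhase_smul S _
    simp_rw [hj]
    rw [← Finset.mul_sum, mul_div_cancel_left₀ _ hL.ne']
  -- Step 1: `L⁻³ Σ_p I_p ≤ Dmax`
  set I : (Fin 3 → ZMod (2 * S + 1)) → ℝ := fun p =>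
    ∫ U, (⨆ h : {h : Site 4 (2 * S + 1) → G // ∀ h', coul U h ≤ coul U h'}, cov U h.1 p) ∂μ with hI
  have hIle : ∀ p, I p ≤ Dmax := fun p => le_ciSup (Finite.bddAbove_range I) p
  have h1 : (1 / (2 * S + 1 : ℝ) ^ 3) * ∑ p, I p ≤ Dmax := by
    rw [div_mul_eq_mul_div, one_mul, div_le_iff₀ hL]
    calc ∑ p, I p ≤ ∑ _p : Fin 3 → ZMod (2 * S + 1), Dmax := Finset.sum_le_sum fun p _ => hIle p
      _ = Dmax * (2 * S + 1 : ℝ) ^ 3 := by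
          rw [Finset.sum_const, Finset.card_univ, nsmul_eq_mul, hcard, mul_comm]
  -- Step 2: `∫ sup_h Amass ≤ Σ_p I_p`
  have h2 : ∫ U, (⨆ h : {h : Site 4 (2 * S + 1) → G // ∀ h', coul U h ≤ coul U h'}, Amass U h.1) ∂μ ≤
      ∑ p, I p := by
    rw [hI, ← integral_finsetSum _ fun p _ => hint p]
    refine integral_mono_of_nonneg (Eventually.of_forall fun U => ?_)
      (integrable_finsetSum _ fun p _ => hint p) (Eventually.of_forall fun U => ?_)
    · refine Real.iSup_nonneg fun h => ?_
      exact Finset.sum_nonneg fun j _ => Finset.sum_nonneg fun y _ =>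
        Finset.sum_nonneg fun a _ => Finset.sum_nonneg fun b _ => by positivity
    · refine Real.iSup_le (fun h => ?_) (Finset.sum_nonneg fun p _ =>
        Real.iSup_nonneg fun h => hcov0 U h.1 p)
      rw [← hpars U h.1]
      exact Finset.sum_le_sum fun p _ => le_ciSup (hbdd U p) h
  calc (1 / (2 * S + 1 : ℝ) ^ 3) *
        ∫ U, (⨆ h : {h : Site 4 (2 * S + 1) → G // ∀ h', coul U h ≤ coul U h'}, Amass U h.1) ∂μ
      ≤ (1 / (2 * S + 1 : ℝ) ^ 3) * ∑ p, I p :=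
        mul_le_mul_of_nonneg_left h2 (by positivity)
    _ ≤ Dmax := h1

end Dmax

end Summit.QuantumFields.YangMills.Theorems.BrascampLiebVacuumSC.Negative

end
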